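import Literature.Geometry.Lorentzian.PenroseConjecture
import Literature.Geometry.Lorentzian.EnclosureArea
import HarnessLib

/-!
# The enclosure vocabulary: agreement of the light copies with the originals
(namespace `Literature.Geometry.Lorentzian`)

`EnclosureArea.lean` re-homes, in the structure namespace `AFEnd` of a light module (import cone:
`TrappedSurface`, `AsymptoticFlatness`, `Volume`), verbatim copies of five notions whose original
declarations sit above the undischarged mass-inequality facts: `IsExteriorRegion` and
`IsWeaklyOuterTrappedFree` (`MassInequalities.lean`), `IsOutsideOf` (`MassCapacity.lean`),
`IsCalS` (`ConformalFlow.lean`) and `minimalEnclosureArea` (`PenroseConjecture.lean`). This file,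
which imports both ends, records that each copy **is** its original — the identifications hold
by `Iff.rfl` / `rfl`, so they double as a compile-time check that the two texts have not
diverged — and transports to the light `A_min` the two identifications that stayed with Bray's
conformal flow (`IsMinimalAreaEnclosure.minimalEnclosureArea_eq`,
`IsOuterMinimizing.minimalEnclosureArea_eq` of `PenroseConjecture.lean`). Statements filed over
`EnclosureArea.lean` (with the `AFEnd.` names) are thereby interchangeable with the hypotheses of
the heavy facts (`riemannian_penrose_inequality_*`, `Bray2001_mass_ge_half_capacity`, …), by
`rw`/`Iff.mp` with the lemmas below or simply by definitional unfolding.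

Nothing here is new mathematics; sources as in the two files (Huisken–Ilmanen 2001, §0 and
Lemma 4.1; Andersson–Metzger 2009, Defs. 7.1–7.2, Thm. 7.3; Bray 2001, §2 Defs. 3, 6, §4 Def. 10;
Mars 2009, §3).
-/

noncomputable section

open Bundle Set Manifold TopologicalSpace Filter MeasureTheory
open scoped ContDiff Topology ENNReal Manifold Real

namespace Literature.Geometry.Lorentzian

open PseudoRiemannianMetric

variable {X : Type} [TopologicalSpace X] [ChartedSpace E3 X]

/-- `IsExteriorRegion e U` (`MassInequalities.lean`) is its light copy `e.IsExteriorRegion U`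
(`EnclosureArea.lean`), definitionally. Huisken–Ilmanen 2001, §0.
[cite: HuiskenIlmanenIMCF2001, §0 exterior region and Lemma 4.1] -/
theorem isExteriorRegion_iff_afEnd {e : AFEnd X} {U : Opens X} :
    IsExteriorRegion e U ↔ e.IsExteriorRegion U :=
  Iff.rfl

/-- The two exterior-region predicates are equal as functions. Huisken–Ilmanen 2001, §0.
[cite: HuiskenIlmanenIMCF2001, §0 exterior region and Lemma 4.1] -/
theorem isExteriorRegion_eq_afEnd :
    @IsExteriorRegion X _ _ = @AFEnd.IsExteriorRegion X _ _ :=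
  rfl

/-- `IsOutsideOf e U f' ν'` (`MassCapacity.lean`) is its light copy `e.IsOutsideOf U f' ν'`
(`EnclosureArea.lean`), definitionally. Bray 2001, §2 Def. 3. [cite: BrayRPI2001, §2 Def. 3] -/
theorem isOutsideOf_iff_afEnd {e : AFEnd X} {U : Opens X} {S' : Type*} {f' : S' → X}
    {ν' : NormalField (𝓡 3) f'} : IsOutsideOf e U f' ν' ↔ e.IsOutsideOf U f' ν' :=
  Iff.rfl

/-- The two outside-region predicates are equal as functions. Bray 2001, §2 Def. 3.
[cite: BrayRPI2001, §2 Def. 3] -/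
theorem isOutsideOf_eq_afEnd {S' : Type*} :
    (fun (e : AFEnd X) (U : Opens X) (f' : S' → X) (ν' : NormalField (𝓡 3) f') ↦
        IsOutsideOf e U f' ν') =
      fun e U f' ν' ↦ e.IsOutsideOf U f' ν' :=
  rfl

section Manifold

variable [IsManifold (𝓡 3) ∞ X]
  (h : ContMDiffRiemannianMetric (𝓡 3) ∞ E3 (TangentSpace (𝓡 3) : X → Type _))

/-- `IsWeaklyOuterTrappedFree h k e U` (`MassInequalities.lean`) is its light copy
`e.IsWeaklyOuterTrappedFree h k U` (`EnclosureArea.lean`), definitionally. Andersson–Metzger 2009,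
Defs. 7.1–7.2. [cite: AnderssonMetzgerTrapped2009, Defs. 7.1–7.2 and Thm. 7.3 (arXiv:0708.4252 numbering)] -/
theorem isWeaklyOuterTrappedFree_iff_afEnd [(ofRiemannian h).HasLeviCivita]
    (k : Π x : X, TangentSpace (𝓡 3) x →L[ℝ] TangentSpace (𝓡 3) x →L[ℝ] ℝ) {e : AFEnd X}
    {U : Opens X} : IsWeaklyOuterTrappedFree h k e U ↔ e.IsWeaklyOuterTrappedFree h k U :=
  Iff.rfl

/-- The two trapped-freeness predicates are equal as functions. Andersson–Metzger 2009,
Defs. 7.1–7.2. [cite: AnderssonMetzgerTrapped2009, Defs. 7.1–7.2 and Thm. 7.3 (arXiv:0708.4252 numbering)] -/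
theorem isWeaklyOuterTrappedFree_eq_afEnd :
    @IsWeaklyOuterTrappedFree X _ _ _ = @AFEnd.IsWeaklyOuterTrappedFree X _ _ _ :=
  rfl

/-- `IsCalS h e V` (`ConformalFlow.lean`) is its light copy `e.IsCalS h V` (`EnclosureArea.lean`),
definitionally. Bray 2001, §2 Def. 3. [cite: BrayRPI2001, §2 Def. 3] -/
theorem isCalS_iff_afEnd {e : AFEnd X} {V : Opens X} : IsCalS h e V ↔ e.IsCalS h V :=
  Iff.rfl

/-- The two `𝒮`-membership predicates are equal as functions. Bray 2001, §2 Def. 3.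
[cite: BrayRPI2001, §2 Def. 3] -/
theorem isCalS_eq_afEnd : @IsCalS X _ _ _ = @AFEnd.IsCalS X _ _ _ :=
  rfl

variable [T2Space X] [LocallyCompactSpace X] [MeasurableSpace X] [BorelSpace X]

/-- `minimalEnclosureArea h e U₀` (`PenroseConjecture.lean`) is its light copy
`e.minimalEnclosureArea h U₀` (`EnclosureArea.lean`), definitionally. Mars 2009, §3.
[cite: Mars2009, §3 (minimal area enclosure, A_min)] -/
theorem minimalEnclosureArea_eq_afEnd (e : AFEnd X) (U₀ : Opens X) :
    minimalEnclosureArea h e U₀ = e.minimalEnclosureArea h U₀ :=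
  rfl

omit [T2Space X] [LocallyCompactSpace X] [MeasurableSpace X] [BorelSpace X] in
/-- The two `A_min` functions are equal. Mars 2009, §3.
[cite: Mars2009, §3 (minimal area enclosure, A_min)] -/
theorem minimalEnclosureArea_eq_afEnd' :
    @minimalEnclosureArea X _ _ _ = @AFEnd.minimalEnclosureArea X _ _ _ :=
  rfl

/-- **The light `A_min` is the area of a minimal area enclosure when `𝒮` contains one**
(transport of `IsMinimalAreaEnclosure.minimalEnclosureArea_eq` of `PenroseConjecture.lean`): if
`frontier V` is a minimal area enclosure of `frontier U₀` in `(X, h)` in Bray's sense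
(`IsMinimalAreaEnclosure` of `ConformalFlow.lean`, conformal factor `1`), then
`e.minimalEnclosureArea h U₀ = |frontier V|`. Bray 2001, §4 Def. 10; Mars 2009, §3.
[cite: Mars2009, §3 (minimal area enclosure, A_min)] -/
theorem IsMinimalAreaEnclosure.afEnd_minimalEnclosureArea_eq {e : AFEnd X} {U₀ V : Opens X}
    (hV : IsMinimalAreaEnclosure h (fun _ ↦ (1 : ℝ)) e U₀ V) :
    e.minimalEnclosureArea h U₀ = area h (frontier (V : Set X)) :=
  hV.minimalEnclosureArea_eq h

/-- **`A_min(Σ) = |Σ|` (light `A_min`) for an outer-minimizing surface `Σ ∈ 𝒮`** (transport of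
`IsOuterMinimizing.minimalEnclosureArea_eq` of `PenroseConjecture.lean`; the time-symmetric
mechanism: outermost minimal surfaces are outer-minimizing, Huisken–Ilmanen 2001, Lemma 4.1 (ii),
so that a Penrose statement over `A_min` is then the Riemannian Penrose inequality).
Bray 2001, §2 Def. 6. [cite: BrayRPI2001, §2 Def. 6] -/
theorem IsOuterMinimizing.afEnd_minimalEnclosureArea_eq {e : AFEnd X} {U₀ : Opens X}
    (hU₀ : e.IsCalS h U₀) (hmin : IsOuterMinimizing h (fun _ ↦ (1 : ℝ)) e U₀) :
    e.minimalEnclosureArea h U₀ = area h (frontier (U₀ : Set X)) :=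
  hmin.minimalEnclosureArea_eq h hU₀

end Manifold

end Literature.Geometry.Lorentzian

end
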